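import Summits.ValiantsHypothesis.ValiantsHypothesis.Theorems.LacunarySymmetroidMatrixDescartesCensusLaguerreSum

/-!
# `MatrixDescartes` census — THEOREM L18-LAGUERRE in the kernel (Laguerre files, part 3b)

HONEST FRAMING.  Object-search cell `pub-symmetroid`, route crux `Theses.LacunarySymmetroid.MatrixDescartes`
(ledger item stmt-ValiantsHypothesis-18050).  ONE theorem, `l18_laguerre` = the cell's **THEOREM L18-LAGUERRE**
(theory-3 g13, bus 2026-08-25T03:43:38Z; READER PASS engine-1 g14 and theory-2 g14): for natural exponents
`d₁ < d₂ < 2d₁`, `2d₂ < d₃` (the «class-G window» `W = (d₁, d₂, 2d₁, d₁+d₂, 2d₂, d₃)`) and reals `u₁,…,u₆ > 0`, if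
`F = u₁X^{d₁} − u₂X^{d₂} + u₃X^{2d₁} − u₄X^{d₁+d₂} + u₅X^{2d₂} − u₆X^{d₃}` has at least FOUR positive roots counted
with multiplicity, then `Φ⁰ := u₂²u₃ − u₁u₂u₄ + u₁²u₅ > 0`.  (The cell's wording assumes five roots — the
Descartes-sharp window of a hypothetical fourteen; Laguerre gives `≤ 3` roots under `Φ⁰ ≤ 0`, so four suffice.  In
the cell's dictionary: «CONJECTURE L_(1,8)(d) holds at every configuration on every class-G support».)

PROOF (the bus proof, made finite): `σ = u₁/u₂`, `ρ = σ^{1/(d₂−d₁)}` (`Real.rpow`; `u₁ρ^{d₁} = u₂ρ^{d₂}`),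
`ĝ = u₃ − u₄σ + u₅σ²` with `u₂²ĝ = Φ⁰ ≤ 0`.  Lower partial sums of `F` at `ρ`, block-wise in the index:
`0, +, 0, +, ρ^{2d₁}(u₃−u₄σ), ρ^{2d₁}ĝ ≤ 0, F(ρ) < 0` ⇒ two weakly-signed blocks (cut at `d₁+d₂` or at `2d₂`
according to the sign of `u₃ − u₄σ`) ⇒ `Var ≤ 1`; upper partial sums `F(ρ), F(ρ)−u₁ρ^{d₁}, F(ρ)` (all `< 0`), then
`v₁`, `v₂ = v₁ + u₄ρ^{d₁+d₂}`, then `−u₆ρ^{d₃}` ⇒ three weakly-signed blocks (if `v₁ > 0` then `v₂ > 0`) ⇒ `Var ≤ 2`;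
the two-sided Laguerre sum form (`…CensusLaguerreSum`) gives `#Z₊(F) ≤ 1 + 2 = 3 < 4`.
Nothing here bears on `ζ_sym`, `DoorA26` / `DoorA34`, CONJECTURE L(d) as a whole, the crux, or `VP ≠ VNP`.

[folklore] — the cell's own elementary theorem; the counting rule is [cite: PolyaSzego1925, Abschn. V Kap. 1 §1 (Laguerre)].
-/

-- `Summit.ValiantsHypothesis.ValiantsHypothesis.…` repeats a component by the D-0017 layout
-- (single-conjunct summit), which the `dupNamespace` linter flags; the name is mandated.
set_option linter.dupNamespace false

namespace Summit.ValiantsHypothesis.ValiantsHypothesis.Theorems.LacunarySymmetroidMatrixDescartes.Census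

open Polynomial Finset
open scoped BigOperators Polynomial

set_option maxHeartbeats 800000 in
/-- **THEOREM L18-LAGUERRE (kernel).**  Let `d₁ < d₂ < 2d₁` and `2d₂ < d₃` (a «class-G» window: the six
exponents `d₁ < d₂ < 2d₁ < d₁+d₂ < 2d₂ < d₃`), `u₁,…,u₆ > 0`, and
`F = u₁X^{d₁} − u₂X^{d₂} + u₃X^{2d₁} − u₄X^{d₁+d₂} + u₅X^{2d₂} − u₆X^{d₃}`.  If `F` has at least four positive
roots (counted with multiplicity) then `Φ⁰ := u₂²u₃ − u₁u₂u₄ + u₁²u₅ > 0`.  (theory-3 g13's statement has «five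
roots», as forced by `V(F) = 5` on a Descartes-sharp window; the Laguerre count gives `≤ 3` roots when `Φ⁰ ≤ 0`.)
PROOF (theory-3 g13, READER PASS engine-1 g14 / theory-2 g14): with `σ = u₁/u₂`, `ρ = σ^{1/(d₂−d₁)}`, the lower
partial sums of `F` at `ρ` have signs `(+, 0, +, ?, ≤0, −)` and the upper ones `(−, −, −, ?, ?′, −)` with `?′ > 0`
whenever `? > 0`; two applications of the block bound give `V ≤ 1` and `V ≤ 2`, and the two-sided Laguerre rule
`#Z₊(F) ≤ 1 + 2 = 3`.  [folklore] cell theorem (pub-symmetroid THEOREM L18-LAGUERRE, 2026-08-25T03:43Z); the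
rule is [cite: PolyaSzego1925, Abschn. V Kap. 1 §1 (Laguerre)]. -/
theorem l18_laguerre {d₁ d₂ d₃ : ℕ} (h12 : d₁ < d₂) (h21 : d₂ < 2 * d₁) (h3 : 2 * d₂ < d₃)
    {u₁ u₂ u₃ u₄ u₅ u₆ : ℝ} (hu₁ : 0 < u₁) (hu₂ : 0 < u₂) (hu₃ : 0 < u₃) (hu₄ : 0 < u₄) (hu₅ : 0 < u₅)
    (hu₆ : 0 < u₆)
    (hZ : 4 ≤ (C u₁ * X ^ d₁ - C u₂ * X ^ d₂ + C u₃ * X ^ (2 * d₁) - C u₄ * X ^ (d₁ + d₂)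
        + C u₅ * X ^ (2 * d₂) - C u₆ * X ^ d₃ : ℝ[X]).roots.countP (fun t => 0 < t)) :
    0 < u₂ ^ 2 * u₃ - u₁ * u₂ * u₄ + u₁ ^ 2 * u₅ := by
  by_contra hΦ
  rw [not_lt] at hΦ
  set F : ℝ[X] := C u₁ * X ^ d₁ - C u₂ * X ^ d₂ + C u₃ * X ^ (2 * d₁) - C u₄ * X ^ (d₁ + d₂)
        + C u₅ * X ^ (2 * d₂) - C u₆ * X ^ d₃ with hF
  -- the point `ρ` with `ρ^(d₂ - d₁) = σ = u₁/u₂`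
  set σ : ℝ := u₁ / u₂ with hσ
  have hσpos : 0 < σ := div_pos hu₁ hu₂
  set δ : ℕ := d₂ - d₁ with hδ
  have hδpos : 0 < δ := by omega
  set ρ : ℝ := σ ^ ((1 : ℝ) / δ) with hρ
  have hρpos : 0 < ρ := Real.rpow_pos_of_pos hσpos _
  have hρδ : ρ ^ δ = σ := by
    rw [hρ, ← Real.rpow_natCast, ← Real.rpow_mul hσpos.le]
    have : (1 : ℝ) / δ * δ = 1 := by field_simp
    rw [this, Real.rpow_one]
  have hρd₂ : ρ ^ d₂ = σ * ρ ^ d₁ := by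
    have : d₂ = d₁ + δ := by omega
    rw [this, pow_add, hρδ, mul_comm]
  have hρd₁d₂ : ρ ^ (d₁ + d₂) = σ * ρ ^ (2 * d₁) := by
    rw [pow_add, hρd₂, two_mul, pow_add]; ring
  have hρ2d₂ : ρ ^ (2 * d₂) = σ ^ 2 * ρ ^ (2 * d₁) := by
    rw [two_mul, pow_add, hρd₂, two_mul, pow_add]; ring
  have hhead : u₁ * ρ ^ d₁ - u₂ * ρ ^ d₂ = 0 := by
    rw [hρd₂, hσ]; field_simp; ring
  -- the block `ĝ(σ) = u₃ − u₄σ + u₅σ² ≤ 0`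
  set g : ℝ := u₃ - u₄ * σ + u₅ * σ ^ 2 with hg
  have hgΦ : u₂ ^ 2 * g = u₂ ^ 2 * u₃ - u₁ * u₂ * u₄ + u₁ ^ 2 * u₅ := by
    have h2 : u₂ ≠ 0 := hu₂.ne'
    rw [hg, hσ, div_pow]
    have e1 : u₂ ^ 2 * (u₄ * (u₁ / u₂)) = u₁ * u₂ * u₄ := by field_simp
    have e2 : u₂ ^ 2 * (u₅ * (u₁ ^ 2 / u₂ ^ 2)) = u₁ ^ 2 * u₅ := by field_simp
    linear_combination -e1 + e2
  have hg0 : g ≤ 0 := by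
    by_contra hpos
    rw [not_le] at hpos
    have : 0 < u₂ ^ 2 * g := mul_pos (pow_pos hu₂ 2) hpos
    linarith
  -- coefficients of `F`
  have hne : d₁ ≠ d₂ ∧ d₁ ≠ 2 * d₁ ∧ d₁ ≠ d₁ + d₂ ∧ d₁ ≠ 2 * d₂ ∧ d₁ ≠ d₃ ∧ d₂ ≠ 2 * d₁ ∧ d₂ ≠ d₁ + d₂ ∧
      d₂ ≠ 2 * d₂ ∧ d₂ ≠ d₃ ∧ 2 * d₁ ≠ d₁ + d₂ ∧ 2 * d₁ ≠ 2 * d₂ ∧ 2 * d₁ ≠ d₃ ∧ d₁ + d₂ ≠ 2 * d₂ ∧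
      d₁ + d₂ ≠ d₃ ∧ 2 * d₂ ≠ d₃ := by omega
  have hcoeff : ∀ j, F.coeff j = (if j = d₁ then u₁ else 0) - (if j = d₂ then u₂ else 0)
      + (if j = 2 * d₁ then u₃ else 0) - (if j = d₁ + d₂ then u₄ else 0) + (if j = 2 * d₂ then u₅ else 0)
      - (if j = d₃ then u₆ else 0) := by
    intro j
    simp only [hF, coeff_add, coeff_sub, coeff_C_mul, coeff_X_pow, mul_ite, mul_one, mul_zero]
  have hdegle : F.natDegree ≤ d₃ := by
    rw [natDegree_le_iff_coeff_eq_zero]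
    intro N hN
    rw [hcoeff]
    rw [if_neg (by omega), if_neg (by omega), if_neg (by omega), if_neg (by omega), if_neg (by omega),
      if_neg (by omega)]
    ring
  have hcd₃ : F.coeff d₃ = -u₆ := by
    rw [hcoeff, if_neg (by omega), if_neg (by omega), if_neg (by omega), if_neg (by omega), if_neg (by omega),
      if_pos rfl]
    ring
  have hdeg : F.natDegree = d₃ := natDegree_eq_of_le_of_coeff_ne_zero hdegle (by rw [hcd₃]; linarith)
  -- lower partial sums `S m = Σ_{j ≤ m} F_j ρ^j` and upper sums `U k = Σ_{k ≤ j ≤ d₃} F_j ρ^j`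
  have hS : ∀ m, ∑ j ∈ range (m + 1), F.coeff j * ρ ^ j =
      (if d₁ ≤ m then u₁ * ρ ^ d₁ else 0) - (if d₂ ≤ m then u₂ * ρ ^ d₂ else 0)
      + (if 2 * d₁ ≤ m then u₃ * ρ ^ (2 * d₁) else 0) - (if d₁ + d₂ ≤ m then u₄ * ρ ^ (d₁ + d₂) else 0)
      + (if 2 * d₂ ≤ m then u₅ * ρ ^ (2 * d₂) else 0) - (if d₃ ≤ m then u₆ * ρ ^ d₃ else 0) := by
    intro m
    simp only [hcoeff, sub_mul, add_mul, Finset.sum_sub_distrib, Finset.sum_add_distrib,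
      sum_range_succ_ite_eq_mul_pow]
  have hU : ∀ k, ∑ j ∈ Icc k d₃, F.coeff j * ρ ^ j =
      (if k ≤ d₁ then u₁ * ρ ^ d₁ else 0) - (if k ≤ d₂ then u₂ * ρ ^ d₂ else 0)
      + (if k ≤ 2 * d₁ then u₃ * ρ ^ (2 * d₁) else 0) - (if k ≤ d₁ + d₂ then u₄ * ρ ^ (d₁ + d₂) else 0)
      + (if k ≤ 2 * d₂ then u₅ * ρ ^ (2 * d₂) else 0) - (if k ≤ d₃ then u₆ * ρ ^ d₃ else 0) := by
    intro k
    simp only [hcoeff, sub_mul, add_mul, Finset.sum_sub_distrib, Finset.sum_add_distrib,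
      sum_Icc_ite_eq_mul_pow u₁ ρ (show d₁ ≤ d₃ by omega), sum_Icc_ite_eq_mul_pow u₂ ρ (show d₂ ≤ d₃ by omega),
      sum_Icc_ite_eq_mul_pow u₃ ρ (show 2 * d₁ ≤ d₃ by omega),
      sum_Icc_ite_eq_mul_pow u₄ ρ (show d₁ + d₂ ≤ d₃ by omega),
      sum_Icc_ite_eq_mul_pow u₅ ρ (show 2 * d₂ ≤ d₃ by omega), sum_Icc_ite_eq_mul_pow u₆ ρ (le_refl d₃)]
  -- `F(ρ) = ρ^{2d₁} g − u₆ ρ^{d₃} < 0`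
  have hFρ : F.eval ρ = ρ ^ (2 * d₁) * g - u₆ * ρ ^ d₃ := by
    rw [eval_eq_sum_range, hdeg, hS d₃, if_pos (by omega), if_pos (by omega), if_pos (by omega),
      if_pos (by omega), if_pos (by omega), if_pos le_rfl, hρd₁d₂, hρ2d₂, hg]
    linear_combination hhead
  have hFρneg : F.eval ρ < 0 := by
    rw [hFρ]
    have h1 : ρ ^ (2 * d₁) * g ≤ 0 := mul_nonpos_of_nonneg_of_nonpos (pow_pos hρpos _).le hg0
    have h2 : 0 < u₆ * ρ ^ d₃ := mul_pos hu₆ (pow_pos hρpos _)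
    linarith
  have hFρne : F.eval ρ ≠ 0 := ne_of_lt hFρneg
  -- Laguerre, two-sided sum form
  have hmain := roots_countP_pos_le_signVariations_lower_add_upper F hρpos hFρne
  rw [hdeg] at hmain
  -- the two carriers and their coefficients
  set Lc : ℝ[X] := ∑ m ∈ range (d₃ + 1), C (∑ j ∈ range (m + 1), F.coeff j * ρ ^ j) * X ^ m with hLc
  set Uc : ℝ[X] := ∑ k ∈ range (d₃ + 1), C (∑ j ∈ Icc k d₃, F.coeff j * ρ ^ j) * X ^ k with hUc
  have hLcc : ∀ i, Lc.coeff i = if i < d₃ + 1 then ∑ j ∈ range (i + 1), F.coeff j * ρ ^ j else 0 :=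
    fun i => coeff_sum_C_mul_X_pow _ _ i
  have hUcc : ∀ i, Uc.coeff i = if i < d₃ + 1 then ∑ j ∈ Icc i d₃, F.coeff j * ρ ^ j else 0 :=
    fun i => coeff_sum_C_mul_X_pow _ _ i
  have hdegLc : Lc.natDegree < d₃ + 1 := by
    have : Lc.natDegree ≤ d₃ := by
      rw [natDegree_le_iff_coeff_eq_zero]; intro N hN; rw [hLcc, if_neg (by omega)]
    omega
  have hdegUc : Uc.natDegree < d₃ + 1 := by
    have : Uc.natDegree ≤ d₃ := by
      rw [natDegree_le_iff_coeff_eq_zero]; intro N hN; rw [hUcc, if_neg (by omega)]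
    omega
  -- useful positive quantities
  have hp₁ : 0 < u₁ * ρ ^ d₁ := mul_pos hu₁ (pow_pos hρpos _)
  have hp₃ : 0 < u₃ * ρ ^ (2 * d₁) := mul_pos hu₃ (pow_pos hρpos _)
  have hp₄ : 0 < u₄ * ρ ^ (d₁ + d₂) := mul_pos hu₄ (pow_pos hρpos _)
  have hp₆ : 0 < u₆ * ρ ^ d₃ := mul_pos hu₆ (pow_pos hρpos _)
  have hρ2d₁ : 0 < ρ ^ (2 * d₁) := pow_pos hρpos _
  -- c₄ := u₃ − u₄σ : the unknown-sign lower block value is ρ^{2d₁} c₄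
  have hblock4 : u₃ * ρ ^ (2 * d₁) - u₄ * ρ ^ (d₁ + d₂) = ρ ^ (2 * d₁) * (u₃ - u₄ * σ) := by
    rw [hρd₁d₂]; ring
  have hblock5 : u₃ * ρ ^ (2 * d₁) - u₄ * ρ ^ (d₁ + d₂) + u₅ * ρ ^ (2 * d₂) = ρ ^ (2 * d₁) * g := by
    rw [hρd₁d₂, hρ2d₂, hg]; ring
  ------------------------------------------------------------------
  -- LOWER CARRIER: `Var(Lc) ≤ 1` by two blocks `[0,p) ≥ 0`, `[p, d₃] ≤ 0`
  ------------------------------------------------------------------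
  have hVL : Lc.signVariations + 1 ≤ 2 := by
    -- cut point
    have key : ∃ p, d₁ + d₂ ≤ p ∧ p ≤ 2 * d₂ ∧ (∀ m, m < p → 0 ≤ Lc.coeff m) ∧ (∀ m, p ≤ m → Lc.coeff m ≤ 0) := by
      by_cases hc4 : u₃ - u₄ * σ ≤ 0
      · refine ⟨d₁ + d₂, le_rfl, by omega, ?_, ?_⟩
        · intro m hm
          rw [hLcc]; split_ifs with hm'
          · rw [hS m, if_neg (show ¬ d₁ + d₂ ≤ m by omega), if_neg (show ¬ 2 * d₂ ≤ m by omega),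
              if_neg (show ¬ d₃ ≤ m by omega)]
            by_cases hm2 : d₂ ≤ m
            · rw [if_pos (by omega), if_pos hm2]
              split_ifs <;> linarith [hhead]
            · rw [if_neg hm2]
              split_ifs <;> linarith
          · exact le_rfl
        · intro m hm
          rw [hLcc]; split_ifs with hm'
          · rw [hS m, if_pos (by omega), if_pos (by omega), if_pos (by omega), if_pos hm]
            by_cases hm5 : 2 * d₂ ≤ m
            · rw [if_pos hm5]
              have e1 : u₁ * ρ ^ d₁ - u₂ * ρ ^ d₂ + u₃ * ρ ^ (2 * d₁) - u₄ * ρ ^ (d₁ + d₂) + u₅ * ρ ^ (2 * d₂)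
                  = ρ ^ (2 * d₁) * g := by linear_combination hhead + hblock5
              have : ρ ^ (2 * d₁) * g ≤ 0 := mul_nonpos_of_nonneg_of_nonpos hρ2d₁.le hg0
              split_ifs <;> linarith
            · rw [if_neg hm5, if_neg (show ¬ d₃ ≤ m by omega)]
              have : ρ ^ (2 * d₁) * (u₃ - u₄ * σ) ≤ 0 := mul_nonpos_of_nonneg_of_nonpos hρ2d₁.le hc4
              linarith [hhead, hblock4]
          · exact le_rfl
      · rw [not_le] at hc4
        refine ⟨2 * d₂, by omega, le_rfl, ?_, ?_⟩
        · intro m hm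
          rw [hLcc]; split_ifs with hm'
          · rw [hS m, if_neg (show ¬ 2 * d₂ ≤ m by omega), if_neg (show ¬ d₃ ≤ m by omega)]
            by_cases hm2 : d₂ ≤ m
            · rw [if_pos (by omega), if_pos hm2]
              have : 0 ≤ ρ ^ (2 * d₁) * (u₃ - u₄ * σ) := (mul_pos hρ2d₁ hc4).le
              split_ifs <;> linarith [hhead, hblock4]
            · rw [if_neg hm2]
              split_ifs <;> linarith
          · exact le_rfl
        · intro m hm
          rw [hLcc]; split_ifs with hm'
          · rw [hS m, if_pos (by omega), if_pos (by omega), if_pos (by omega), if_pos (by omega), if_pos hm]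
            have e1 : u₁ * ρ ^ d₁ - u₂ * ρ ^ d₂ + u₃ * ρ ^ (2 * d₁) - u₄ * ρ ^ (d₁ + d₂) + u₅ * ρ ^ (2 * d₂)
                = ρ ^ (2 * d₁) * g := by linear_combination hhead + hblock5
            have : ρ ^ (2 * d₁) * g ≤ 0 := mul_nonpos_of_nonneg_of_nonpos hρ2d₁.le hg0
            split_ifs <;> linarith
          · exact le_rfl
    obtain ⟨p, hp1, hp2, hlo, hhi⟩ := key
    set c : ℕ → ℕ := fun i => if i = 0 then 0 else if i = 1 then p else d₃ + 1 with hc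
    have hc0 : c 0 = 0 := by simp [hc]
    have hc1 : c 1 = p := by simp [hc]
    have hc2 : c 2 = d₃ + 1 := by simp [hc]
    have hcmono : Monotone c := by
      apply monotone_nat_of_le_succ
      intro n
      rcases n with _ | n
      · rw [hc0]; exact Nat.zero_le _
      · have e : c (n + 1 + 1) = d₃ + 1 := by
          simp only [hc, show n + 1 + 1 ≠ 0 by omega, show n + 1 + 1 ≠ 1 by omega, if_false]
        rw [e]
        by_cases hn : n = 0
        · subst hn; rw [show (0 : ℕ) + 1 = 1 from rfl, hc1]; omega
        · have e' : c (n + 1) = d₃ + 1 := by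
            simp only [hc, show n + 1 ≠ 0 by omega, show n + 1 ≠ 1 by omega, if_false]
          rw [e']
    refine signVariations_succ_le_of_blocks 2 Lc c hc0 hcmono (by rw [hc2]; exact hdegLc) ?_
    intro i hi
    interval_cases i
    · refine ⟨1, Or.inl rfl, fun m _ hm => ?_⟩
      rw [show (0 : ℕ) + 1 = 1 from rfl, hc1] at hm
      rw [one_mul]; exact hlo m hm
    · refine ⟨-1, Or.inr rfl, fun m hm _ => ?_⟩
      rw [hc1] at hm
      have := hhi m hm; linarith
  ------------------------------------------------------------------
  -- UPPER CARRIER: `Var(Uc) ≤ 2` by three blocks `−`, `(?)`, `−`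
  ------------------------------------------------------------------
  have hVU : Uc.signVariations + 1 ≤ 3 := by
    -- the head blocks are `F(ρ)` or `F(ρ) − u₁ρ^{d₁}`, both negative
    set v₁ : ℝ := -(u₄ * ρ ^ (d₁ + d₂)) + u₅ * ρ ^ (2 * d₂) - u₆ * ρ ^ d₃ with hv₁
    set v₂ : ℝ := u₅ * ρ ^ (2 * d₂) - u₆ * ρ ^ d₃ with hv₂
    have hUval : ∀ k, k < d₃ + 1 → Uc.coeff k =
        (if k ≤ d₁ then u₁ * ρ ^ d₁ else 0) - (if k ≤ d₂ then u₂ * ρ ^ d₂ else 0)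
        + (if k ≤ 2 * d₁ then u₃ * ρ ^ (2 * d₁) else 0) - (if k ≤ d₁ + d₂ then u₄ * ρ ^ (d₁ + d₂) else 0)
        + (if k ≤ 2 * d₂ then u₅ * ρ ^ (2 * d₂) else 0) - u₆ * ρ ^ d₃ := by
      intro k hk
      rw [hUcc, if_pos hk, hU k, if_pos (show k ≤ d₃ by omega)]
    have hFρ' : F.eval ρ = u₁ * ρ ^ d₁ - u₂ * ρ ^ d₂ + u₃ * ρ ^ (2 * d₁) - u₄ * ρ ^ (d₁ + d₂)
        + u₅ * ρ ^ (2 * d₂) - u₆ * ρ ^ d₃ := by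
      rw [hFρ]; linear_combination -hhead - hblock5
    -- head: k ≤ 2 d₁ ⇒ Uc.coeff k < 0
    have hheadneg : ∀ k, k ≤ 2 * d₁ → Uc.coeff k < 0 := by
      intro k hk
      rw [hUval k (by omega), if_pos hk, if_pos (show k ≤ d₁ + d₂ by omega), if_pos (show k ≤ 2 * d₂ by omega)]
      by_cases hk1 : k ≤ d₁
      · rw [if_pos hk1, if_pos (show k ≤ d₂ by omega)]; linarith [hFρ', hFρneg]
      · rw [if_neg hk1]
        by_cases hk2 : k ≤ d₂
        · rw [if_pos hk2]; linarith [hFρ', hFρneg, hp₁]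
        · rw [if_neg hk2]; linarith [hFρ', hFρneg, hhead]
    -- middle blocks
    have hmid₁ : ∀ k, 2 * d₁ < k → k ≤ d₁ + d₂ → Uc.coeff k = v₁ := by
      intro k hk1 hk2
      rw [hUval k (by omega), if_neg (by omega), if_neg (by omega), if_neg (by omega), if_pos hk2,
        if_pos (show k ≤ 2 * d₂ by omega), hv₁]; ring
    have hmid₂ : ∀ k, d₁ + d₂ < k → k ≤ 2 * d₂ → Uc.coeff k = v₂ := by
      intro k hk1 hk2
      rw [hUval k (by omega), if_neg (by omega), if_neg (by omega), if_neg (by omega), if_neg (by omega),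
        if_pos hk2, hv₂]; ring
    have htail : ∀ k, 2 * d₂ < k → Uc.coeff k ≤ 0 := by
      intro k hk
      by_cases hk' : k < d₃ + 1
      · rw [hUval k hk', if_neg (by omega), if_neg (by omega), if_neg (by omega), if_neg (by omega),
          if_neg (by omega)]; linarith
      · rw [hUcc, if_neg hk']
    have hv₁₂ : v₂ = v₁ + u₄ * ρ ^ (d₁ + d₂) := by rw [hv₁, hv₂]; ring
    -- blocks: [0,q) «−», [q, 2d₂+1) «ε», [2d₂+1, d₃+1) «−»
    have key : ∃ q, ∃ ε : ℝ, (ε = 1 ∨ ε = -1) ∧ 2 * d₁ + 1 ≤ q ∧ q ≤ 2 * d₂ + 1 ∧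
        (∀ k, k < q → Uc.coeff k ≤ 0) ∧ (∀ k, q ≤ k → k < 2 * d₂ + 1 → 0 ≤ ε * Uc.coeff k) := by
      by_cases hv1 : v₁ ≤ 0
      · refine ⟨d₁ + d₂ + 1, if 0 ≤ v₂ then 1 else -1, ?_, by omega, by omega, ?_, ?_⟩
        · split_ifs
          · exact Or.inl rfl
          · exact Or.inr rfl
        · intro k hk
          by_cases hk1 : k ≤ 2 * d₁
          · exact (hheadneg k hk1).le
          · rw [hmid₁ k (by omega) (by omega)]; exact hv1
        · intro k hk1 hk2
          rw [hmid₂ k (by omega) (by omega)]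
          split_ifs with hv2
          · linarith
          · rw [not_le] at hv2; linarith
      · rw [not_le] at hv1
        have hv2 : 0 < v₂ := by rw [hv₁₂]; linarith
        refine ⟨2 * d₁ + 1, 1, Or.inl rfl, le_rfl, by omega, ?_, ?_⟩
        · intro k hk; exact (hheadneg k (by omega)).le
        · intro k hk1 hk2
          rw [one_mul]
          by_cases hk3 : k ≤ d₁ + d₂
          · rw [hmid₁ k (by omega) hk3]; exact hv1.le
          · rw [hmid₂ k (by omega) (by omega)]; exact hv2.le
    obtain ⟨q, ε, hε, hq1, hq2, hlo, hmd⟩ := key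
    set c : ℕ → ℕ := fun i => if i = 0 then 0 else if i = 1 then q else if i = 2 then 2 * d₂ + 1 else d₃ + 1
      with hc
    have hc0 : c 0 = 0 := by simp [hc]
    have hc1 : c 1 = q := by simp [hc]
    have hc2 : c 2 = 2 * d₂ + 1 := by simp [hc]
    have hc3 : c 3 = d₃ + 1 := by simp [hc]
    have hcge : ∀ n, 3 ≤ n → c n = d₃ + 1 := by
      intro n hn
      simp only [hc, show n ≠ 0 by omega, show n ≠ 1 by omega, show n ≠ 2 by omega, if_false]
    have hcmono : Monotone c := by
      apply monotone_nat_of_le_succ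
      intro n
      rcases n with _ | n
      · rw [hc0]; exact Nat.zero_le _
      rcases n with _ | n
      · rw [show (0 : ℕ) + 1 = 1 from rfl, hc1, show (1 : ℕ) + 1 = 2 from rfl, hc2]; omega
      rcases n with _ | n
      · rw [show (0 : ℕ) + 1 + 1 = 2 from rfl, hc2, show (2 : ℕ) + 1 = 3 from rfl, hc3]; omega
      · rw [hcge _ (by omega), hcge _ (by omega)]
    refine signVariations_succ_le_of_blocks 3 Uc c hc0 hcmono (by rw [hc3]; exact hdegUc) ?_
    intro i hi
    interval_cases i
    · refine ⟨-1, Or.inr rfl, fun k _ hk => ?_⟩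
      rw [show (0 : ℕ) + 1 = 1 from rfl, hc1] at hk
      have := hlo k hk; linarith
    · refine ⟨ε, hε, fun k hk1 hk2 => ?_⟩
      rw [hc1] at hk1
      rw [show (1 : ℕ) + 1 = 2 from rfl, hc2] at hk2
      exact hmd k hk1 hk2
    · refine ⟨-1, Or.inr rfl, fun k hk _ => ?_⟩
      rw [hc2] at hk
      have := htail k (by omega); linarith
  -- contradiction: `4 ≤ #Z₊(F) ≤ Var(Lc) + Var(Uc) ≤ 1 + 2`
  have : F.roots.countP (fun t => 0 < t) ≤ 3 := by
    have h := hmain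
    change F.roots.countP (fun t => 0 < t) ≤ Lc.signVariations + Uc.signVariations at h
    omega
  omega

end Summit.ValiantsHypothesis.ValiantsHypothesis.Theorems.LacunarySymmetroidMatrixDescartes.Census
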